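import Summits.RiemannHypothesis.RiemannHypothesis.Theorems.TiltedLandingLaw421R3MenuThinLeaf

/-!
# W-09 · C4 «kernel desk» (rh-idea-6 g46) — «MenuThinBox»: the T-side box lemma `G ≥ 9/25` for every legal datum, and the PH assembly of the reduced leaf

SUPPORT toward crux ⟨stmt-RiemannHypothesis-27010⟩ `…EarlyAppointments.TiltedLandingLaw421RT`; file B of (CA1206)(2)/(CA1207)(5) over #1323 «MenuThinTop»
(170: `GBoundOn`, `JBoundOn`, `gBoundOn_of_mediant`, `limAjd`, `limHroom`, `limTg`) and #171 «MenuThinLeaf» (`ReducedLeaf3Sig`, `UniformBoxesSig`,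
`FlatDoors3Sig`, `dlBoundOn_one`, `reducedLeaf3_of_uniform`, `certificatesExistThinSig_of_uniform`).
§1 THE T-BOX LEMMA — RE-HOMED FROM C3 g59's scratch B «FlatMenuCorner» (sha16 8388250f, ns `RhW08.C3g59b`; mediant split = scratch A «FlatMenu»
571f20c4 `GPairAt`/`tRem_of_tPair`), proofs verbatim up to the spelling `(0 − ξ)² ↦ ξ²` and the split of the lid quartic into its two cases
(default heartbeats): the mediant pair `(9/25)·cn_{ih} ≤ cn_w`, `(9/25)·cn_w·ξ² ≤ cn_{ih}·(δ−ξ)²` on the thin boundary is reduced to three CORNER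
instances (columns monotone in `b²`; lid component 1 a convex quadratic in `ξ`; lid component 2 a quartic by four sub-cases) and the corners are
proved from the NF binders (`corner1` by an explicit SOS certificate after the t-elimination `4δ² < ht + h²/16`); ★ `gBox_925 :
BoxSig (GBoundOn (9/25))` — `G ≥ 9/25` in product form for EVERY legal NF datum.  §2 THE PH ASSEMBLY (triple of record `(j, d, g) = (9/2, 1, 9/25)`,
(CA1207)(5)): ★ `uniformBoxes_PH_of_J : BoxSig (JBoundOn (9/2)) → UniformBoxesSig (9/2) (9/25)`, ★★ `reducedLeaf3_of_PH : BoxSig (JBoundOn (9/2)) →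
FlatDoors3Sig (9/2) 1 (9/25) → ReducedLeaf3Sig`, `certificatesExistThinSig_of_PH` — so the E5 leaf waits on exactly TWO inputs: the A-side
box-lemma `J ≤ 9/2` (C3's `ARemSig (9/2)`; RESULT-6: mean value + the pointwise `D(x)·A_w·C_w ≤ 9·cn_w`, float sup 1.94) and the 2-variable package
`FlatDoors3Sig (9/2) 1 (9/25)` (= C1 g42's `MenuFlatPH` = C3's `FlatMenuPH`, certified exactly; form of record = C1's reflective «FlatMenuBB»).
Nothing in this file bears on the truth of RH; `ReducedLeaf3Sig`, `FlatDoors3Sig (9/2) 1 (9/25)`, the leaf and ⟨27010⟩ stay OPEN.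
-/

noncomputable section

namespace RhW08.MenuThinBox

open RhW08.SinkBdry RhW08.SinkConePos RhW08.MenuThin RhW08.MenuThinNF RhW08.MenuThinQR RhW08.LimitMenu RhW08.MenuThinTop RhW08.MenuThinLeaf

/-- a boundary family `P h δ t` holding for EVERY legal normal-form datum of #1311's `MenuThinCertFormSig` (the exact NF binders). -/
def BoxSig (P : ℝ → ℝ → ℝ → Prop) : Prop :=
  ∀ (s h δ t Y : ℝ),
    0 < s → 2 * s ≤ h → 3 * h < 2 → 0 < Y → Y ≤ h → 0 < t → t < Y → Y - s / 4 < t → δ ^ 2 + t ^ 2 < Y ^ 2 → 0 ≤ δ → P h δ t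

/-! ## §1 The T-box lemma `G ≥ 9/25` (C3 g59 «FlatMenuCorner», re-homed) -/

/-- (C3) column, first mediant component: monotone in `b²` (`g ≤ 1`) ⇒ the lid corner `b = 1 − h` suffices. -/
theorem pair1_col_of_corner {g h δ t ξ b : ℝ} (hg1 : g ≤ 1) (hb0 : 0 ≤ b) (hb : b ≤ 1 - h)
    (hc : g * (ξ ^ 2 + h ^ 2 - (1 - h) ^ 2) ≤ (δ - ξ) ^ 2 + t ^ 2 - (1 - h) ^ 2) :
    g * (ξ ^ 2 + h ^ 2 - b ^ 2) ≤ (δ - ξ) ^ 2 + t ^ 2 - b ^ 2 := by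
  have hb2 : b ^ 2 ≤ (1 - h) ^ 2 := by nlinarith [mul_le_mul hb hb hb0 (le_trans hb0 hb)]
  nlinarith [mul_nonneg (sub_nonneg.mpr hg1) (sub_nonneg.mpr hb2)]

/-- (C3) column (`ξ² = 1`), second mediant component: monotone in `b²` once `g ≤ (δ − ξ)²` ⇒ the lid corner suffices. -/
theorem pair2_col_of_corner {g h δ t ξ b : ℝ} (hξ : ξ ^ 2 = 1) (hgX : g ≤ (δ - ξ) ^ 2) (hb0 : 0 ≤ b) (hb : b ≤ 1 - h)
    (hc : g * ((δ - ξ) ^ 2 + t ^ 2 - (1 - h) ^ 2) * ξ ^ 2 ≤ (ξ ^ 2 + h ^ 2 - (1 - h) ^ 2) * (δ - ξ) ^ 2) :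
    g * ((δ - ξ) ^ 2 + t ^ 2 - b ^ 2) * ξ ^ 2 ≤ (ξ ^ 2 + h ^ 2 - b ^ 2) * (δ - ξ) ^ 2 := by
  have hb2 : b ^ 2 ≤ (1 - h) ^ 2 := by nlinarith [mul_le_mul hb hb hb0 (le_trans hb0 hb)]
  rw [hξ] at hc ⊢
  nlinarith [mul_nonneg (sub_nonneg.mpr hgX) (sub_nonneg.mpr hb2)]

/-- (C3) lid, first component: `D(ξ) − D(1) = (ξ − 1)((1 − g)(ξ + 1) − 2δ) ≥ 0` for `|ξ| ≥ 1`, `0 ≤ δ ≤ 1 − g`. -/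
theorem pair1_lid_of_corner {g h δ t ξ : ℝ} (hg1 : g ≤ 1) (hδ0 : 0 ≤ δ) (hδ : δ ≤ 1 - g) (hξ : 1 ≤ |ξ|)
    (hc : g * (1 ^ 2 + h ^ 2 - (1 - h) ^ 2) ≤ (δ - 1) ^ 2 + t ^ 2 - (1 - h) ^ 2) :
    g * (ξ ^ 2 + h ^ 2 - (1 - h) ^ 2) ≤ (δ - ξ) ^ 2 + t ^ 2 - (1 - h) ^ 2 := by
  rcases le_abs'.mp hξ with hl | hr
  · have h1 : 0 ≤ (1 - g) * (-(ξ + 1)) := mul_nonneg (sub_nonneg.mpr hg1) (by linarith)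
    nlinarith [mul_nonneg (by linarith : (0 : ℝ) ≤ 1 - ξ) (by linarith : (0 : ℝ) ≤ 2 * δ - (1 - g) * (ξ + 1))]
  · have h1 : (1 - g) * 2 ≤ (1 - g) * (ξ + 1) := mul_le_mul_of_nonneg_left (by linarith) (sub_nonneg.mpr hg1)
    nlinarith [mul_nonneg (by linarith : (0 : ℝ) ≤ ξ - 1) (by linarith : (0 : ℝ) ≤ (1 - g) * (ξ + 1) - 2 * δ)]

/-- (C3) lid quartic, case `t² ≤ (1−h)²`: `0 ≤ P := (δ−ξ)²·((16/25)ξ² + h² − (1−h)²) + (9/25)·ξ²·((1−h)² − t²)` (near/far sub-cases, no corner needed). -/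
theorem pair2_lid_keyA {h δ t ξ : ℝ} (hh : 0 < h) (hδ0 : 0 ≤ δ) (hδ : 2 * δ ≤ h) (hth : t ^ 2 < h ^ 2) (hξ : 1 ≤ |ξ|)
    (hξ2 : 1 ≤ ξ ^ 2) (hb : t ^ 2 ≤ (1 - h) ^ 2) :
    0 ≤ (δ - ξ) ^ 2 * ((16 / 25 : ℝ) * ξ ^ 2 + h ^ 2 - (1 - h) ^ 2) + (9 / 25 : ℝ) * ξ ^ 2 * ((1 - h) ^ 2 - t ^ 2) := by
  have hδ2 : 4 * δ ^ 2 ≤ h ^ 2 := by nlinarith [mul_le_mul hδ hδ (by positivity) hh.le]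
  have hbr : 2 * h - 9 / 25 ≤ (16 / 25 : ℝ) * ξ ^ 2 + h ^ 2 - (1 - h) ^ 2 := by nlinarith [hξ2]
  by_cases hbr0 : 0 ≤ (16 / 25 : ℝ) * ξ ^ 2 + h ^ 2 - (1 - h) ^ 2
  · exact add_nonneg (mul_nonneg (sq_nonneg _) hbr0) (mul_nonneg (mul_nonneg (by norm_num) (sq_nonneg ξ)) (sub_nonneg.mpr hb))
  push Not at hbr0
  rcases le_abs'.mp hξ with hl | hr
  · have hX0 : 0 ≤ δ - ξ := by linarith
    have hX1 : δ - ξ ≤ -ξ * (1 + δ) := by nlinarith [mul_nonneg hδ0 (by linarith : (0 : ℝ) ≤ -ξ - 1)]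
    have hX : (δ - ξ) ^ 2 ≤ ξ ^ 2 * (1 + δ) ^ 2 := by nlinarith [mul_le_mul hX1 hX1 hX0 (le_trans hX0 hX1)]
    have h1 : ξ ^ 2 * (1 + δ) ^ 2 * ((16 / 25 : ℝ) * ξ ^ 2 + h ^ 2 - (1 - h) ^ 2) ≤ (δ - ξ) ^ 2 * ((16 / 25 : ℝ) * ξ ^ 2 + h ^ 2 - (1 - h) ^ 2) :=
      mul_le_mul_of_nonpos_right hX hbr0.le
    have hE3 : 0 ≤ (1 + δ) ^ 2 * (2 * h - 9 / 25) + 9 / 25 * ((1 - h) ^ 2 - t ^ 2) := by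
      nlinarith [mul_nonneg hh.le hδ0, mul_nonneg hh.le (sq_nonneg δ), hth, hδ, hδ2, mul_pos hh (by linarith : (0 : ℝ) < 1 - h)]
    have hE2 : (1 + δ) ^ 2 * (2 * h - 9 / 25) ≤ (1 + δ) ^ 2 * ((16 / 25 : ℝ) * ξ ^ 2 + h ^ 2 - (1 - h) ^ 2) := mul_le_mul_of_nonneg_left hbr (sq_nonneg _)
    have h3 : 0 ≤ ξ ^ 2 * ((1 + δ) ^ 2 * ((16 / 25 : ℝ) * ξ ^ 2 + h ^ 2 - (1 - h) ^ 2) + 9 / 25 * ((1 - h) ^ 2 - t ^ 2)) :=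
      mul_nonneg (sq_nonneg ξ) (by linarith)
    nlinarith [h1, h3]
  · have hX : (δ - ξ) ^ 2 ≤ ξ ^ 2 := by nlinarith [mul_nonneg hδ0 (by linarith : (0 : ℝ) ≤ 2 * ξ - δ)]
    have h1 : ξ ^ 2 * ((16 / 25 : ℝ) * ξ ^ 2 + h ^ 2 - (1 - h) ^ 2) ≤ (δ - ξ) ^ 2 * ((16 / 25 : ℝ) * ξ ^ 2 + h ^ 2 - (1 - h) ^ 2) :=
      mul_le_mul_of_nonpos_right hX hbr0.le
    have h2 : 0 ≤ (16 / 25 : ℝ) * (ξ ^ 2 - (1 - h) ^ 2 + h ^ 2) + 9 / 25 * (h ^ 2 - t ^ 2) := by nlinarith [hξ2, hth]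
    have h3 : 0 ≤ ξ ^ 2 * ((16 / 25 : ℝ) * (ξ ^ 2 - (1 - h) ^ 2 + h ^ 2) + 9 / 25 * (h ^ 2 - t ^ 2)) := mul_nonneg (sq_nonneg ξ) h2
    nlinarith [h1, h3]

/-- (C3) lid quartic, case `t² > (1−h)²` (so `2h > 1`, bracket `> 0`): far by `(δ−ξ)² ≥ ξ²`, near by `(ξ−δ)² ≥ ξ²(1−δ)²` and the near CORNER. -/
theorem pair2_lid_keyB {h δ t ξ : ℝ} (hh1 : h < 1) (hδ0 : 0 ≤ δ) (hδ : 2 * δ ≤ h) (hth : t ^ 2 < h ^ 2) (hξ : 1 ≤ |ξ|) (hξ2 : 1 ≤ ξ ^ 2)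
    (hb : (1 - h) ^ 2 < t ^ 2)
    (hc : (9 / 25 : ℝ) * ((δ - 1) ^ 2 + t ^ 2 - (1 - h) ^ 2) * 1 ^ 2 ≤ (1 ^ 2 + h ^ 2 - (1 - h) ^ 2) * (δ - 1) ^ 2) :
    0 ≤ (δ - ξ) ^ 2 * ((16 / 25 : ℝ) * ξ ^ 2 + h ^ 2 - (1 - h) ^ 2) + (9 / 25 : ℝ) * ξ ^ 2 * ((1 - h) ^ 2 - t ^ 2) := by
  have hbr : 2 * h - 9 / 25 ≤ (16 / 25 : ℝ) * ξ ^ 2 + h ^ 2 - (1 - h) ^ 2 := by nlinarith [hξ2]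
  have h2h : 0 < 2 * h - 1 := by nlinarith
  have hbrpos : 0 ≤ (16 / 25 : ℝ) * ξ ^ 2 + h ^ 2 - (1 - h) ^ 2 := by nlinarith [sq_nonneg ξ]
  rcases le_abs'.mp hξ with hl | hr
  · have hX : ξ ^ 2 ≤ (δ - ξ) ^ 2 := by nlinarith [mul_nonneg hδ0 (by linarith : (0 : ℝ) ≤ -ξ), sq_nonneg δ]
    have h1 : ξ ^ 2 * ((16 / 25 : ℝ) * ξ ^ 2 + h ^ 2 - (1 - h) ^ 2) ≤ (δ - ξ) ^ 2 * ((16 / 25 : ℝ) * ξ ^ 2 + h ^ 2 - (1 - h) ^ 2) :=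
      mul_le_mul_of_nonneg_right hX hbrpos
    have h2 : 0 ≤ (16 / 25 : ℝ) * (ξ ^ 2 - (1 - h) ^ 2 + h ^ 2) + 9 / 25 * (h ^ 2 - t ^ 2) := by nlinarith [hξ2, hth]
    have h3 : 0 ≤ ξ ^ 2 * ((16 / 25 : ℝ) * (ξ ^ 2 - (1 - h) ^ 2 + h ^ 2) + 9 / 25 * (h ^ 2 - t ^ 2)) := mul_nonneg (sq_nonneg ξ) h2
    nlinarith [h1, h3]
  · have hX0 : 0 ≤ ξ * (1 - δ) := mul_nonneg (by linarith) (by linarith)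
    have hX1 : ξ * (1 - δ) ≤ ξ - δ := by nlinarith [mul_nonneg hδ0 (by linarith : (0 : ℝ) ≤ ξ - 1)]
    have hX : ξ ^ 2 * (1 - δ) ^ 2 ≤ (δ - ξ) ^ 2 := by nlinarith [mul_le_mul hX1 hX1 hX0 (le_trans hX0 hX1)]
    have h1 : ξ ^ 2 * (1 - δ) ^ 2 * ((16 / 25 : ℝ) * ξ ^ 2 + h ^ 2 - (1 - h) ^ 2) ≤ (δ - ξ) ^ 2 * ((16 / 25 : ℝ) * ξ ^ 2 + h ^ 2 - (1 - h) ^ 2) :=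
      mul_le_mul_of_nonneg_right hX hbrpos
    have hc' : 9 / 25 * (t ^ 2 - (1 - h) ^ 2) ≤ (1 - δ) ^ 2 * (2 * h - 9 / 25) := by nlinarith [hc]
    have h4 : (1 - δ) ^ 2 * (2 * h - 9 / 25) ≤ (1 - δ) ^ 2 * ((16 / 25 : ℝ) * ξ ^ 2 + h ^ 2 - (1 - h) ^ 2) := mul_le_mul_of_nonneg_left hbr (sq_nonneg _)
    have h6 : 0 ≤ ξ ^ 2 * ((1 - δ) ^ 2 * ((16 / 25 : ℝ) * ξ ^ 2 + h ^ 2 - (1 - h) ^ 2) - 9 / 25 * (t ^ 2 - (1 - h) ^ 2)) :=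
      mul_nonneg (sq_nonneg ξ) (by linarith)
    nlinarith [h1, h6]

/-- (C3) lid, second mediant component (the quartic), `g = 9/25`, from the two cases and the near corner.  Needs `0 ≤ 2δ ≤ h < 1`, `t² < h²`. -/
theorem pair2_lid_925 {h δ t ξ : ℝ} (hh : 0 < h) (hh1 : h < 1) (hδ0 : 0 ≤ δ) (hδ : 2 * δ ≤ h) (hth : t ^ 2 < h ^ 2) (hξ : 1 ≤ |ξ|)
    (hc : (9 / 25 : ℝ) * ((δ - 1) ^ 2 + t ^ 2 - (1 - h) ^ 2) * 1 ^ 2 ≤ (1 ^ 2 + h ^ 2 - (1 - h) ^ 2) * (δ - 1) ^ 2) :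
    (9 / 25 : ℝ) * ((δ - ξ) ^ 2 + t ^ 2 - (1 - h) ^ 2) * ξ ^ 2 ≤ (ξ ^ 2 + h ^ 2 - (1 - h) ^ 2) * (δ - ξ) ^ 2 := by
  have hξ2 : 1 ≤ ξ ^ 2 := by
    have hm := mul_le_mul hξ hξ zero_le_one (abs_nonneg ξ)
    rw [abs_mul_abs_self] at hm
    nlinarith [hm]
  rcases le_or_gt (t ^ 2) ((1 - h) ^ 2) with hb | hb
  · nlinarith [pair2_lid_keyA hh hδ0 hδ hth hξ hξ2 hb]
  · nlinarith [pair2_lid_keyB hh1 hδ0 hδ hth hξ hξ2 hb hc]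

/-- (C3) ★ CORNER 1 (T-i at the near top corner `u = 1 + i(1−h)`, the coupled one): `(9/25)·2h ≤ 2h − h² − 2δ + δ² + t²` from `0 ≤ 2δ ≤ h < 2/3`
and the t-elimination `4δ² < ht + h²/16`; case `δ ≤ h/8` linear, case `δ > h/8` by `h²t² > (4δ² − h²/16)²` and the SOS certificate
`h·Φ = h³(1 − 3h/2)(32h/25 − 2δ) + 16h(δ² − h²/8)² + (9/2)h³(δ − h/3)² + (1113/6400)h⁵`. -/
theorem corner1 {h δ t : ℝ} (hh : 0 < h) (h3 : 3 * h < 2) (hδh : 2 * δ ≤ h) (h4 : 4 * δ ^ 2 < h * t + h ^ 2 / 16) :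
    (9 / 25 : ℝ) * (1 ^ 2 + h ^ 2 - (1 - h) ^ 2) ≤ (δ - 1) ^ 2 + t ^ 2 - (1 - h) ^ 2 := by
  by_cases hc : δ ≤ h / 8
  · nlinarith [sq_nonneg δ, sq_nonneg t, mul_pos hh (by linarith : (0 : ℝ) < 1 - h)]
  · push Not at hc
    have hq : 0 < 4 * δ ^ 2 - h ^ 2 / 16 := by nlinarith [mul_lt_mul'' hc hc (by positivity) (by positivity)]
    have hq2 : (4 * δ ^ 2 - h ^ 2 / 16) ^ 2 < h ^ 2 * t ^ 2 := by
      have h4' : 4 * δ ^ 2 - h ^ 2 / 16 < h * t := by linarith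
      nlinarith [mul_lt_mul'' h4' h4' hq.le hq.le]
    have key : 0 ≤ h * (h ^ 2 * (δ ^ 2 - 2 * δ + 32 / 25 * h - h ^ 2) + (4 * δ ^ 2 - h ^ 2 / 16) ^ 2) := by
      have i : h * (h ^ 2 * (δ ^ 2 - 2 * δ + 32 / 25 * h - h ^ 2) + (4 * δ ^ 2 - h ^ 2 / 16) ^ 2) =
          h ^ 3 * (1 - 3 / 2 * h) * (32 / 25 * h - 2 * δ) + 16 * h * (δ ^ 2 - h ^ 2 / 8) ^ 2 + 9 / 2 * h ^ 3 * (δ - h / 3) ^ 2 +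
            1113 / 6400 * h ^ 5 := by ring
      rw [i]
      have p1 : 0 ≤ h ^ 3 * (1 - 3 / 2 * h) * (32 / 25 * h - 2 * δ) := mul_nonneg (mul_nonneg (pow_nonneg hh.le 3) (by linarith)) (by linarith)
      positivity
    have key' : 0 ≤ h ^ 2 * (δ ^ 2 - 2 * δ + 32 / 25 * h - h ^ 2) + (4 * δ ^ 2 - h ^ 2 / 16) ^ 2 := by
      by_contra hn
      push Not at hn
      nlinarith [mul_pos hh (neg_pos.mpr hn)]
    nlinarith [key', hq2, pow_pos hh 2]

/-- (C3) CORNER 2 (T-ii at `u = 1 + i(1−h)`): `(9/25)(2h − h² − 2δ + δ² + t²) ≤ 2h(1 − δ)²` (`δ ≤ 1/3`, `δ² + t² < h²`). -/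
theorem corner2near {h δ t : ℝ} (hh : 0 < h) (h3 : 3 * h < 2) (hδ0 : 0 ≤ δ) (hδh : 2 * δ ≤ h) (hdt : δ ^ 2 + t ^ 2 < h ^ 2) :
    (9 / 25 : ℝ) * ((δ - 1) ^ 2 + t ^ 2 - (1 - h) ^ 2) * 1 ^ 2 ≤ (1 ^ 2 + h ^ 2 - (1 - h) ^ 2) * (δ - 1) ^ 2 := by
  have u1 : (4 / 9 : ℝ) ≤ (δ - 1) ^ 2 := by
    nlinarith [mul_le_mul (by linarith : (2 / 3 : ℝ) ≤ 1 - δ) (by linarith : (2 / 3 : ℝ) ≤ 1 - δ) (by norm_num) (by linarith)]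
  nlinarith [mul_le_mul_of_nonneg_left u1 (by linarith : (0 : ℝ) ≤ 2 * h), hdt, mul_nonneg hh.le hδ0]

/-- (C3) CORNER 3 (T-ii at the far top corner `u = −1 + i(1−h)`): `(9/25)(2h − h² + 2δ + δ² + t²) ≤ 2h(1 + δ)²`. -/
theorem corner2far {h δ t : ℝ} (hh : 0 < h) (hδ0 : 0 ≤ δ) (hδh : 2 * δ ≤ h) (hdt : δ ^ 2 + t ^ 2 < h ^ 2) :
    (9 / 25 : ℝ) * ((δ - -1) ^ 2 + t ^ 2 - (1 - h) ^ 2) * (-1) ^ 2 ≤ ((-1) ^ 2 + h ^ 2 - (1 - h) ^ 2) * (δ - -1) ^ 2 := by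
  have u1 : (1 : ℝ) ≤ (δ - -1) ^ 2 := by nlinarith
  nlinarith [mul_le_mul_of_nonneg_left u1 (by linarith : (0 : ℝ) ≤ 2 * h), hdt, mul_nonneg hh.le hδ0]

/-- the binder facts every corner uses: `0 < h < 1`, `2δ ≤ h`, `δ < h`, the t-elimination `4δ² < ht + h²/16`, `t² < h²`, `δ² + t² < h²`. -/
theorem nf_facts {s h δ t Y : ℝ} (hs : 0 < s) (hsh : 2 * s ≤ h) (h3 : 3 * h < 2) (hY : 0 < Y) (hYh : Y ≤ h) (ht : 0 < t) (htY : t < Y)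
    (hdrop : Y - s / 4 < t) (hnest : δ ^ 2 + t ^ 2 < Y ^ 2) (hδ : 0 ≤ δ) :
    0 < h ∧ h < 1 ∧ 2 * δ ≤ h ∧ δ < h ∧ 4 * δ ^ 2 < h * t + h ^ 2 / 16 ∧ t ^ 2 < h ^ 2 ∧ δ ^ 2 + t ^ 2 < h ^ 2 := by
  have hh : 0 < h := by linarith
  have hYt : 0 < Y + t := by linarith
  have hp1 : (Y - t) * (Y + t) < h / 8 * (Y + t) := mul_lt_mul_of_pos_right (by linarith) hYt
  have hp2 : h / 8 * (Y + t) < h / 8 * (2 * t + h / 8) := mul_lt_mul_of_pos_left (by linarith) (by positivity)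
  have hp3 : h / 8 * (Y + t) ≤ h / 8 * (2 * h) := mul_le_mul_of_nonneg_left (by linarith) (by positivity)
  have hδ2 : 4 * δ ^ 2 < h ^ 2 := by nlinarith [hp1, hp3]
  have hδh : 2 * δ < h := by nlinarith [hδ2, hδ, hh, (by positivity : (0 : ℝ) ≤ 2 * δ + h)]
  refine ⟨hh, by linarith, hδh.le, by linarith, by nlinarith [hp1, hp2], ?_, by nlinarith [mul_le_mul hYh hYh hY.le hh.le]⟩
  nlinarith [mul_lt_mul'' htY htY ht.le ht.le, mul_le_mul hYh hYh hY.le hh.le]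

/-- ★ THE T-BOX LEMMA: `G ≥ 9/25` in product form (`GBoundOn (9/25)`) on the thin boundary for EVERY legal NF datum (C3 g59 `tPairSig_925` + #170's
`gBoundOn_of_mediant`). -/
theorem gBox_925 : BoxSig (GBoundOn (9 / 25)) := by
  intro s h δ t Y hs hsh h3 hY hYh ht htY hdrop hnest hδ
  obtain ⟨hh, hh1, hδh, hδlt, h4, hth, hdt⟩ := nf_facts hs hsh h3 hY hYh ht htY hdrop hnest hδ
  have hg1 : (9 / 25 : ℝ) ≤ 1 := by norm_num
  have c1 := corner1 hh h3 hδh h4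
  have c2 := corner2near hh h3 hδ hδh hdt
  have c3 := corner2far hh hδ hδh hdt
  have c1far : (9 / 25 : ℝ) * ((-1) ^ 2 + h ^ 2 - (1 - h) ^ 2) ≤ (δ - -1) ^ 2 + t ^ 2 - (1 - h) ^ 2 := by nlinarith [c1, hδ]
  have hgX1 : (9 / 25 : ℝ) ≤ (δ - 1) ^ 2 := by
    nlinarith [mul_le_mul (by linarith : (2 / 3 : ℝ) ≤ 1 - δ) (by linarith : (2 / 3 : ℝ) ≤ 1 - δ) (by norm_num) (by linarith)]
  have hgX2 : (9 / 25 : ℝ) ≤ (δ - -1) ^ 2 := by nlinarith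
  refine gBoundOn_of_mediant hh hh1.le hδ hδlt ⟨fun b hb0 hb => ⟨?_, ?_⟩, fun b hb0 hb => ⟨?_, ?_⟩, fun ξ hξ => ⟨?_, ?_⟩, fun ξ hξ => ⟨?_, ?_⟩⟩
  · exact pair1_col_of_corner hg1 hb0 hb c1
  · exact pair2_col_of_corner (by norm_num) hgX1 hb0 hb c2
  · exact pair1_col_of_corner hg1 hb0 hb c1far
  · exact pair2_col_of_corner (by norm_num) hgX2 hb0 hb c3
  · exact pair1_lid_of_corner hg1 hδ (by linarith) (hξ.trans (le_abs_self ξ)) c1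
  · exact pair2_lid_925 hh hh1 hδ hδh hth (hξ.trans (le_abs_self ξ)) c2
  · exact pair1_lid_of_corner hg1 hδ (by linarith) (hξ.trans (neg_le_abs ξ)) c1
  · exact pair2_lid_925 hh hh1 hδ hδh hth (hξ.trans (neg_le_abs ξ)) c2

/-! ## §2 The PH assembly of the reduced leaf (over #171) -/

/-- `Dl ≤ 1` for every legal NF datum (#171 `dlBoundOn_one`). -/
theorem dlBox_one : BoxSig (DlBoundOn 1) := fun s h _ t _ hs hsh h3 _ _ ht _ _ _ _ => dlBoundOn_one (by linarith) (by linarith) ht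

/-- ★ the A-side box lemma `J ≤ 9/2` (OPEN: C3's `ARemSig (9/2)`) is all that #171's `UniformBoxesSig (9/2) (9/25)` still needs. -/
theorem uniformBoxes_PH_of_J (hJ : BoxSig (JBoundOn (9 / 2))) : UniformBoxesSig (9 / 2) (9 / 25) :=
  fun s h δ t Y hs hsh h3 hY hYh ht htY hdrop hnest hδ =>
    ⟨hJ s h δ t Y hs hsh h3 hY hYh ht htY hdrop hnest hδ, gBox_925 s h δ t Y hs hsh h3 hY hYh ht htY hdrop hnest hδ⟩

/-- ★★ THE PH ASSEMBLY: `J ≤ 9/2` for every legal datum and the flat package `(9/2, 1, 9/25)` give the reduced leaf (`G ≥ 9/25` from §1, `Dl ≤ 1` free). -/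
theorem reducedLeaf3_of_PH (hJ : BoxSig (JBoundOn (9 / 2))) (hF : FlatDoors3Sig (9 / 2) 1 (9 / 25)) : ReducedLeaf3Sig :=
  reducedLeaf3_of_uniform (uniformBoxes_PH_of_J hJ) hF

/-- by name: the same two inputs close the sink certificates of #1303 (through #171 and #1315). -/
theorem certificatesExistThinSig_of_PH (hJ : BoxSig (JBoundOn (9 / 2))) (hF : FlatDoors3Sig (9 / 2) 1 (9 / 25)) :
    RhW08.SinkThin.CertificatesExistThinSig (Real.sqrt 5 / 2) :=
  certificatesExistThinSig_of_reduced3 (reducedLeaf3_of_PH hJ hF)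

end RhW08.MenuThinBox

end
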